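import Literature.NumberTheory.GaloisRepresentations.ContinuousCohomologyConnecting
import HarnessLib

/-!
# X11b, route R1 — erratum Lemma 2.1, cohomological core: `H¹(Γ, M[r]) ≅ H¹(Γ, M)[r]`

HONEST FRAMING (cell `b2b-bsdres`, run/shared/lean/b2b/bsd-rank1-residual/, verbatim in every
file): the goal of the cell is to DELETE the COMBINATION-SHAPED residual classes of the
Birch–Swinnerton-Dyer formula for ALL analytic-rank `≤ 1` elliptic curves over `ℚ` — "full BSD
formula for every rank `≤ 1` curve in class `C`" assembled STRICTLY from published theorems — so
that the rank-`≤ 1` remainder becomes exactly the CONSTRUCTION-SHAPED classes, which are TYPED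
(missing-input `Prop`s), NOT attempted. This is not "finishing BSD". Sub-cell
`b2b-bsdres-multr1-p1` (X11b via the re-proof of Castella 2018 Thm. A along the author's erratum):
a RESEARCH ROUTE; no claim beyond the stated class; X11b stays CONSTRUCTION-SHAPED; nothing here
changes a label. No named fact is introduced (definitions with bodies and theorems only; no
`sorry`).

## What this file kernel-checks

The erratum proves its Thm. 1.1 (the anticyclotomic IMC for `E` at `p ∥ N`) from Thm. 2.3 (IMC
for `p`-ordinary newforms `g_m` of weight `k_m > 2` congruent to `f_E` modulo `p^m`) by comparing
Selmer groups under congruences; the comparison is Lemma 2.1: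

> **Lemma 2.1.** Suppose `Σ` contains all primes `v ∤ p` where `T_g` is ramified, `ρ̄_g|_{G_K}`
> is irreducible, and `H⁰(K_𝔭̄, A_g[ϖ]) = 0`. Then the inclusion `M_g[ϖ^m] ⊂ M_g` induces an
> isomorphism `Sel^Σ_𝔭̄(K, M_g[ϖ^m]) ≃ Sel^Σ_𝔭̄(K, M_g)[ϖ^m]`.
> *Proof.* … Since `H⁰(K, M_g) = H⁰(K_∞, A_g) = 0` by Shapiro's lemma and the irreducibility of
> `ρ̄_g|_{G_K}`, the inclusion `M_g[ϖ^m] → M_g` induces an isomorphism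
> `H¹(G_{K,S}, M_g[ϖ^m]) ≃ H¹(G_{K,S}, M_g)[ϖ^m]`. By definition, under the above identification
> `Sel^Σ_𝔭̄(K, M_g)[ϖ^m]` is the kernel of the composite map
> `H¹(G_{K,S}, M_g[p^m]) → H¹(K_𝔭̄, M_g[ϖ^m]) → H¹(K_𝔭̄, M_g)[ϖ^m]`. Since the kernel of the second
> arrow is given by `H⁰(K_𝔭̄, M_g)/ϖ^m H⁰(K_𝔭̄, M_g)` and this vanishes when so does
> `H⁰(K_𝔭̄, A_g[ϖ])`, the proof concludes. □

This file proves the COHOMOLOGICAL CORE of that proof for an ARBITRARY topological group `Γ`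
(`G_{K,S}`, `G_K`, `G_{K_𝔭̄}`), an arbitrary coefficient ring `A` (`𝒪`, `Λ_𝒪`), a discrete
`A`-linear `Γ`-module `M` (the tree's `ContinuousRep Γ A M` with `[DiscreteTopology M]`; `M_g`)
and a scalar `r ∈ A` (`ϖ^m`, `p^m`) acting surjectively on `M` (`M_g = T_g ⊗ Λ_𝒪^*` is
divisible), on Mathlib's continuous cohomology via the tree's long exact sequence in low degrees
(`IsSES.δ₀`, `exists_δ₀_eq_of_map_one_eq_zero`, `exists_map_one_eq_of_map_one_eq_zero` of
`Literature/NumberTheory/GaloisRepresentations/ContinuousCohomologyConnecting.lean`):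

* `torsionRep ρ r` (`M[r]`), `torsionIncl` (`ι : M[r] ⊂ M`), `smulHom` (`[r] : M → M`),
  `isSES_torsion` (`0 → M[r] → M →ʳ M → 0` is short exact for `r`-divisible `M`);
* `cohomologyMap_smulHom_one` (`H¹([r]) = r`), `range_cohomologyMap_torsionIncl`
  (**`im H¹(ι) = H¹(Γ, M)[r]`**), `cohomologyMap_torsionIncl_eq_zero_iff`
  (**`ker H¹(ι) = δ₀(M^Γ)`**), `cohomologyMap_torsionIncl_injective` (**`H¹(ι)` is injective iff-
  direction: as soon as `M^Γ` is `r`-divisible**, i.e. "`H⁰/r H⁰ = 0`" — the erratum's local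
  criterion at `𝔭̄`), `…_of_invariants_eq_bot` (the global criterion `H⁰ = 0`);
* `forall_invariant_eq_zero_of_torsionBy` / `invariants_eq_bot_of_torsionBy`: for `r`-primary `M`,
  `M[r]^Γ = 0 ⟹ M^Γ = 0` (the reduction of "`H⁰(K_𝔭̄, M_g)/ϖ^m = 0`" to a statement about the
  `ϖ`-torsion);
* `torsionH1Equiv`: **`H¹(Γ, M[r]) ≃ₗ[A] H¹(Γ, M)[r]`** under the two hypotheses.

The Selmer-group form of Lemma 2.1 (kernels of restriction maps to a family of subgroups /
decomposition groups) is assembled from these in `SelmerTorsionControl.lean`. What stays INPUT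
(arithmetic, not constructible in the tree today): the objects `M_g = T_g ⊗ Λ_𝒪^*` themselves,
"`H⁰(K, M_g) = 0` by Shapiro's lemma and irreducibility", and the unipotence of `Λ_𝒪^*[ϖ]` as a
`G_{K_𝔭̄}`-module that reduces `H⁰(K_𝔭̄, M_g[ϖ]) = 0` to hypothesis `H⁰(K_𝔭̄, A_g[ϖ]) = 0`
(= erratum hypothesis (iv) `E(ℚ_p)[p] = 0` for `g = f_E`). CONDITIONAL on nothing; deletes
nothing; X11b stays CONSTRUCTION-SHAPED.

`-- TODO(general form): torsion `M[𝔞]` by a finitely generated ideal `𝔞` (the shape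
`H¹(G_{K,S}, M_𝐟[℘̃]) = H¹(G_{K,S}, M_𝐟)[℘̃]` of [Cas18, proof of Thm. 2.6], after [SU14, §3]);
only the principal case `𝔞 = (r)` used by the erratum is done here.`

References: F. Castella, *Erratum to "On the p-part of the Birch–Swinnerton-Dyer formula for
multiplicative primes"*, Lemma 2.1 [Castella2018Erratum]; J.-P. Serre, *Galois Cohomology*, I §2.2
(long exact sequence) [SerreGaloisCohomology1997]; C. Skinner, Pacific J. Math. 283 (2016), §2.6
[Skinner2016PacificMC].
-/

noncomputable section

open CategoryTheory Literature.NumberTheory.GaloisRepresentations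
open scoped ContRepresentation

universe u

namespace Summit.BirchSwinnertonDyer.Rank1Residual.X11b.TorsionControl

variable {A : Type*} [CommRing A] [TopologicalSpace A]
variable {Γ : Type u} [Group Γ] [TopologicalSpace Γ]
variable {M : Type u} [AddCommGroup M] [Module A M] [TopologicalSpace M]

section Objects

/-! ### The `r`-torsion subrepresentation `M[r]` and the two morphisms `ι : M[r] → M`, `[r] : M → M` -/

/-- `M[r]` is `Γ`-stable (the action is `A`-linear). [folklore] -/
theorem torsionBy_le_comap (ρ : ContinuousRep Γ A M) (r : A) (g : Γ) :
    Submodule.torsionBy A M r ≤ (Submodule.torsionBy A M r).comap (ρ g) := by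
  intro m hm
  rw [Submodule.mem_comap, Submodule.mem_torsionBy_iff, ← map_smul,
    (Submodule.mem_torsionBy_iff r m).1 hm, map_zero]

/-- The discrete `Γ`-module `M[r] = {m ∈ M | r • m = 0}` (subrepresentation on the `r`-torsion).
[folklore] -/
def torsionRep (ρ : ContinuousRep Γ A M) (r : A) : ContinuousRep Γ A (Submodule.torsionBy A M r) :=
  ρ.subrepresentation _ (torsionBy_le_comap ρ r)

/-- Unfolding `torsionRep`. [folklore] -/
@[simp] theorem torsionRep_apply_coe (ρ : ContinuousRep Γ A M) (r : A) (g : Γ)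
    (m : Submodule.torsionBy A M r) : ((torsionRep ρ r) g m : M) = ρ g m := rfl

variable [DiscreteTopology M] [ContinuousSMul A M] (ρ : ContinuousRep Γ A M) (r : A)

/-- The inclusion `ι : M[r] ↪ M` as a morphism of the attached topological representations.
[folklore] -/
def torsionIncl : (torsionRep ρ r).toTopRep ⟶ ρ.toTopRep :=
  TopRep.ofHom ⟨⟨(Submodule.torsionBy A M r).subtype, continuous_subtype_val⟩, fun σ => by
    ext m; rfl⟩

/-- Unfolding `torsionIncl`: it is the coercion `M[r] → M`. [folklore] -/
@[simp] theorem torsionIncl_apply (m : Submodule.torsionBy A M r) :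
    (torsionIncl ρ r).hom m = (m : M) := rfl

/-- Multiplication by `r` on `M` as an endomorphism of the attached topological representation
(equivariant because the action is `A`-linear). [folklore] -/
def smulHom : ρ.toTopRep ⟶ ρ.toTopRep :=
  TopRep.ofHom ⟨⟨r • LinearMap.id, continuous_of_discreteTopology⟩, fun σ => by
    ext m
    change r • (ρ σ m) = ρ σ (r • m)
    rw [map_smul]⟩

/-- Unfolding `smulHom`: `m ↦ r • m`. [folklore] -/
@[simp] theorem smulHom_apply (m : M) : (smulHom ρ r).hom m = r • m := rfl

/-- **`0 → M[r] → M →ʳ M → 0` is short exact** when `M` is `r`-divisible. [folklore] -/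
theorem isSES_torsion (hr : Function.Surjective fun m : M => r • m) :
    IsSES (torsionIncl ρ r) (smulHom ρ r) where
  comp_eq_zero := by
    ext m
    exact (Submodule.mem_torsionBy_iff r (m : M)).1 m.2
  injective := Subtype.val_injective
  exact_mid := fun y hy => ⟨⟨y, (Submodule.mem_torsionBy_iff r y).2 hy⟩, rfl⟩
  surjective := hr

end Objects

section Cohomology

variable [IsTopologicalGroup Γ] [DiscreteTopology M] [ContinuousSMul A M]
  (ρ : ContinuousRep Γ A M) (r : A)

/-! ### `H¹` of the two morphisms -/

/-- **`H¹([r]) = r`**: the map induced on `H¹(Γ, M)` by multiplication by `r` on `M` is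
multiplication by `r` (on crossed homomorphisms `[r] ∘ φ = r • φ`). [folklore] -/
theorem cohomologyMap_smulHom_one (y : continuousCohomology 1 ρ.toTopRep) :
    cohomologyMap (smulHom ρ r) 1 y = r • y := by
  obtain ⟨φ, rfl⟩ := oneCocycleClass_surjective ρ.toTopRep y
  rw [cohomologyMap_oneCocycleClass]
  have h1 : contOneCocycles.pullback (ContinuousMonoidHom.id _) (resIdHom (smulHom ρ r)) φ = r • φ :=
    Subtype.ext (ContinuousMap.ext fun σ => rfl)
  rw [h1]
  exact oneCocycleClass_smul (X := ρ.toTopRep) r φ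

/-- The image of `H¹(ι) : H¹(Γ, M[r]) → H¹(Γ, M)` is killed by `r`. [folklore] -/
theorem smul_cohomologyMap_torsionIncl (x : continuousCohomology 1 (torsionRep ρ r).toTopRep) :
    r • cohomologyMap (torsionIncl ρ r) 1 x = 0 := by
  obtain ⟨φ, rfl⟩ := oneCocycleClass_surjective _ x
  rw [cohomologyMap_oneCocycleClass, ← oneCocycleClass_smul]
  have h0 : r • contOneCocycles.pullback (ContinuousMonoidHom.id _) (resIdHom (torsionIncl ρ r)) φ
      = 0 :=
    Subtype.ext (ContinuousMap.ext fun σ => (Submodule.mem_torsionBy_iff r _).1 (φ.1 σ).2)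
  rw [h0]
  exact oneCocycleClass_zero _

/-- **Exactness at `H¹(Γ, M)`, torsion form**: a class of `H¹(Γ, M)` killed by `r` comes from
`H¹(Γ, M[r])` (for `M` `r`-divisible). [folklore] -/
theorem exists_cohomologyMap_torsionIncl_eq (hr : Function.Surjective fun m : M => r • m)
    (y : continuousCohomology 1 ρ.toTopRep) (hy : r • y = 0) :
    ∃ x, cohomologyMap (torsionIncl ρ r) 1 x = y :=
  (isSES_torsion ρ r hr).exists_map_one_eq_of_map_one_eq_zero y
    (by rw [cohomologyMap_smulHom_one]; exact hy)

/-- **`im (H¹(Γ, M[r]) → H¹(Γ, M)) = H¹(Γ, M)[r]`** for `r`-divisible `M`. [folklore] -/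
theorem range_cohomologyMap_torsionIncl (hr : Function.Surjective fun m : M => r • m) :
    Set.range (cohomologyMap (torsionIncl ρ r) 1) =
      {y : continuousCohomology 1 ρ.toTopRep | r • y = 0} := by
  ext y
  constructor
  · rintro ⟨x, rfl⟩
    exact smul_cohomologyMap_torsionIncl ρ r x
  · exact fun hy => exists_cohomologyMap_torsionIncl_eq ρ r hr y hy

/-- **Kernel of `H¹(ι)`**: a class of `H¹(Γ, M[r])` dying in `H¹(Γ, M)` is `δ₀` of an invariant of
`M` (exactness of `M^Γ →δ₀ H¹(Γ, M[r]) → H¹(Γ, M)`). [folklore] -/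
theorem cohomologyMap_torsionIncl_eq_zero_iff (hr : Function.Surjective fun m : M => r • m)
    (x : continuousCohomology 1 (torsionRep ρ r).toTopRep) :
    cohomologyMap (torsionIncl ρ r) 1 x = 0 ↔ ∃ v, (isSES_torsion ρ r hr).δ₀ v = x := by
  constructor
  · exact (isSES_torsion ρ r hr).exists_δ₀_eq_of_map_one_eq_zero x
  · rintro ⟨v, rfl⟩
    exact (isSES_torsion ρ r hr).map_one_δ₀ v

/-- **Injectivity criterion**: `H¹(Γ, M[r]) → H¹(Γ, M)` is injective as soon as `M^Γ` is
`r`-divisible (`δ₀ = 0`), in particular when `M^Γ = 0`. [folklore] -/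
theorem cohomologyMap_torsionIncl_injective (hr : Function.Surjective fun m : M => r • m)
    (hdiv : ∀ v ∈ ρ.toTopRep.ρ.invariants, ∃ w ∈ ρ.toTopRep.ρ.invariants, r • w = v) :
    Function.Injective (cohomologyMap (torsionIncl ρ r) 1) := by
  intro x x' hxx'
  rw [← sub_eq_zero] at hxx' ⊢
  rw [← map_sub] at hxx'
  obtain ⟨v, hv⟩ := (cohomologyMap_torsionIncl_eq_zero_iff ρ r hr _).1 hxx'
  rw [← hv, (isSES_torsion ρ r hr).δ₀_eq_zero_iff]
  obtain ⟨w, hw, hwv⟩ := hdiv v.1 v.2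
  exact ⟨w, hw, hwv⟩

/-- **Injectivity when `H⁰(Γ, M) = 0`.** [folklore] -/
theorem cohomologyMap_torsionIncl_injective_of_invariants_eq_bot
    (hr : Function.Surjective fun m : M => r • m) (h0 : ρ.toTopRep.ρ.invariants = ⊥) :
    Function.Injective (cohomologyMap (torsionIncl ρ r) 1) :=
  cohomologyMap_torsionIncl_injective ρ r hr fun v hv => ⟨0, Submodule.zero_mem _, by
    rw [h0, Submodule.mem_bot] at hv; rw [hv, smul_zero]⟩

/-! ### Vanishing of invariants from the `r`-torsion; the comparison isomorphism -/

omit [IsTopologicalGroup Γ] [DiscreteTopology M] [ContinuousSMul A M] in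
/-- **`M[r]^Γ = 0` and `M` `r`-primary ⟹ `M^Γ = 0`**: if every element of `M` is killed by a
power of `r` and no nonzero `r`-torsion element is `Γ`-invariant, then `M` has no nonzero
`Γ`-invariant (a nonzero invariant `m` with `rⁿ m = 0`, `n` minimal, gives the invariant
`r`-torsion element `rⁿ⁻¹ m ≠ 0`). This is the reduction "`H⁰(K_𝔭̄, M_g) = 0` when so does
`H⁰(K_𝔭̄, A_g[ϖ])`"-type step of the erratum's proof of Lemma 2.1. [folklore] -/
theorem forall_invariant_eq_zero_of_torsionBy (hprim : ∀ m : M, ∃ n : ℕ, r ^ n • m = 0)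
    (h0 : ∀ m : M, r • m = 0 → (∀ g : Γ, ρ g m = m) → m = 0) :
    ∀ m : M, (∀ g : Γ, ρ g m = m) → m = 0 := by
  intro m hm
  obtain ⟨n, hn⟩ := hprim m
  induction n generalizing m with
  | zero => simpa using hn
  | succ n ih =>
    -- `r^n • m` is killed by `r` and invariant, hence zero; then apply the induction hypothesis
    have h1 : r ^ n • m = 0 :=
      h0 _ (by rw [smul_smul, ← pow_succ', hn]) fun g => by rw [map_smul, hm g]
    exact ih m hm h1

omit [IsTopologicalGroup Γ] in
/-- The same with the conclusion as `M^Γ = ⊥` (invariants of the attached topological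
representation). [folklore] -/
theorem invariants_eq_bot_of_torsionBy (hprim : ∀ m : M, ∃ n : ℕ, r ^ n • m = 0)
    (h0 : ∀ m : M, r • m = 0 → (∀ g : Γ, ρ g m = m) → m = 0) :
    ρ.toTopRep.ρ.invariants = ⊥ :=
  (Submodule.eq_bot_iff _).2 fun m hm =>
    forall_invariant_eq_zero_of_torsionBy ρ r hprim h0 m fun g => hm g

omit [IsTopologicalGroup Γ] in
/-- Under `M^Γ = 0`, the invariants are (trivially) `r`-divisible — the form of the hypothesis
used by `cohomologyMap_torsionIncl_injective`. [folklore] -/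
theorem invariants_divisible_of_eq_bot (h0 : ρ.toTopRep.ρ.invariants = ⊥) :
    ∀ v ∈ ρ.toTopRep.ρ.invariants, ∃ w ∈ ρ.toTopRep.ρ.invariants, r • w = v := fun v hv =>
  ⟨0, Submodule.zero_mem _, by rw [h0, Submodule.mem_bot] at hv; rw [hv, smul_zero]⟩

/-- `H¹(ι)` as an `A`-linear map (the underlying linear map of the `TopModuleCat` morphism).
[folklore] -/
abbrev torsionInclH1 :
    continuousCohomology 1 (torsionRep ρ r).toTopRep →ₗ[A] continuousCohomology 1 ρ.toTopRep :=
  (cohomologyMap (torsionIncl ρ r) 1).hom.toLinearMap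

/-- Unfolding `torsionInclH1`. [folklore] -/
@[simp] theorem torsionInclH1_apply (x : continuousCohomology 1 (torsionRep ρ r).toTopRep) :
    torsionInclH1 ρ r x = cohomologyMap (torsionIncl ρ r) 1 x := rfl

/-- `im H¹(ι) = H¹(Γ, M)[r]` as submodules. [folklore] -/
theorem range_torsionInclH1 (hr : Function.Surjective fun m : M => r • m) :
    LinearMap.range (torsionInclH1 ρ r) =
      Submodule.torsionBy A (continuousCohomology 1 ρ.toTopRep) r := by
  ext y
  rw [LinearMap.mem_range, Submodule.mem_torsionBy_iff]
  exact Set.ext_iff.1 (range_cohomologyMap_torsionIncl ρ r hr) y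

/-- **The comparison isomorphism `H¹(Γ, M[r]) ≃ H¹(Γ, M)[r]`** (induced by the inclusion
`M[r] ⊂ M`), for `M` `r`-divisible with `r`-divisible invariants (e.g. `M^Γ = 0`): the
cohomological core of [Castella, Erratum, Lemma 2.1] ("the inclusion `M_g[ϖ^m] → M_g` induces an
isomorphism `H¹(G_{K,S}, M_g[ϖ^m]) ≃ H¹(G_{K,S}, M_g)[ϖ^m]`", from `H⁰(K, M_g) = 0`).
[cite: Castella2018Erratum, Lemma 2.1 (proof)] -/
def torsionH1Equiv (hr : Function.Surjective fun m : M => r • m)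
    (hdiv : ∀ v ∈ ρ.toTopRep.ρ.invariants, ∃ w ∈ ρ.toTopRep.ρ.invariants, r • w = v) :
    continuousCohomology 1 (torsionRep ρ r).toTopRep ≃ₗ[A]
      Submodule.torsionBy A (continuousCohomology 1 ρ.toTopRep) r :=
  LinearEquiv.ofBijective
    ((torsionInclH1 ρ r).codRestrict _ fun x =>
      (Submodule.mem_torsionBy_iff r _).2 (smul_cohomologyMap_torsionIncl ρ r x))
    ⟨fun x x' h => cohomologyMap_torsionIncl_injective ρ r hr hdiv (congrArg Subtype.val h),
      fun y => by
        obtain ⟨x, hx⟩ := exists_cohomologyMap_torsionIncl_eq ρ r hr y.1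
          ((Submodule.mem_torsionBy_iff r _).1 y.2)
        exact ⟨x, Subtype.ext hx⟩⟩

/-- Unfolding `torsionH1Equiv`: its underlying map is `H¹(ι)`. [folklore] -/
@[simp] theorem torsionH1Equiv_apply_coe (hr : Function.Surjective fun m : M => r • m)
    (hdiv : ∀ v ∈ ρ.toTopRep.ρ.invariants, ∃ w ∈ ρ.toTopRep.ρ.invariants, r • w = v)
    (x : continuousCohomology 1 (torsionRep ρ r).toTopRep) :
    (torsionH1Equiv ρ r hr hdiv x : continuousCohomology 1 ρ.toTopRep) =
      cohomologyMap (torsionIncl ρ r) 1 x := rfl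

end Cohomology

end Summit.BirchSwinnertonDyer.Rank1Residual.X11b.TorsionControl

end
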